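import Mathlib
import Summits.Ventures.PercRepro.TriangleCapFourBelowResidueF

/-!
# PercRepro — THE SUB-DIAGONAL `r = 4` WITHOUT THE PRODUCT HYPOTHESIS, AND THE DENSE CELLS WITHOUT A RESIDUE
(p3, gen 39; part 135)

**The products.** `a (k − a)` is concave in `a`: `prod_le_of_small` (`a′ ≤ c` or `a′ ≥ k − c`, `2c ≤ k` ⇒
`a′ (k − a′) ≤ c (k − c)`), `prod_ge_of_between` (`c ≤ a′ ≤ k − c` ⇒ `c (k − c) ≤ a′ (k − a′)`); hence
**`products_avoid`**: for `1 ≤ a` with `2a + 4 ≤ k` the four numbers `a (k − a) − 4, …, a (k − a) − 1` are not of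
the form `a′ (k − a′)` — the previous product `(a − 1)(k − a + 1)` is `k − 2a + 1 ≥ 5` below, the next
`(a + 1)(k − a − 1)` is above.  **`four_below_diagonal_exact_k4m_three_all` / `_four_all`**: the cells `a = 3`
and `a = 4` of the sub-diagonal `r = 4` are exact on the `K₄⁻`-free class for EVERY `k ≥ 13`.
**`four_below_diagonal_exact_k4m_of_dense`**: when `a (k − a) + 10 ≥ 4k` the one-triangle residue is never
needed (`10 q + 2m + 28 ≥ 8k`), so the cell is exact modulo the products alone — **`_of_six`** (every `a ≥ 6`
with `2a + 4 ≤ k`, `k ≥ 13`) and **`_of_five`** (`a = 5`, `k ≥ 15`) are then unconditional.  Axioms: standard.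
-/

namespace PercRepro

namespace TriangleCap

namespace C047

/-- Concavity of `a′ (k − a′)`: between `c` and `k − c` the product is at least `c (k − c)`. -/
theorem prod_ge_of_between (a' k c : ℕ) (h1 : c ≤ a') (h2 : a' + c ≤ k) : c * (k - c) ≤ a' * (k - a') := by
  obtain ⟨x, rfl⟩ : ∃ x, a' = c + x := ⟨a' - c, by omega⟩
  obtain ⟨y, rfl⟩ : ∃ y, k = c + x + y := ⟨k - (c + x), by omega⟩
  have e1 : c + x + y - c = x + y := by omega
  have e2 : c + x + y - (c + x) = y := by omega
  rw [e1, e2]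
  have hcy : c ≤ y := by omega
  nlinarith [Nat.mul_le_mul_left x hcy]

/-- Concavity of `a′ (k − a′)`: outside `[c, k − c]` the product is at most `c (k − c)`. -/
theorem prod_le_of_small (a' k c : ℕ) (hk : a' ≤ k) (hc : 2 * c ≤ k) (h : a' ≤ c ∨ k ≤ a' + c) :
    a' * (k - a') ≤ c * (k - c) := by
  rcases h with h | h
  · exact prod_ge_of_between c k a' h (by omega)
  · have e : k - (k - a') = a' := by omega
    have := prod_ge_of_between c k (k - a') (by omega) (by omega)
    rw [e] at this
    rw [mul_comm]
    exact this

/-- **THE FOUR NUMBERS BELOW `a (k − a)` ARE NOT PRODUCTS** when `2a + 4 ≤ k`. -/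
theorem products_avoid (k a : ℕ) (ha : 1 ≤ a) (hak : 2 * a + 4 ≤ k) :
    ∀ a', a' ≤ k → a * (k - a) - 4 ≠ a' * (k - a') ∧ a * (k - a) - 3 ≠ a' * (k - a') ∧
      a * (k - a) - 2 ≠ a' * (k - a') ∧ a * (k - a) - 1 ≠ a' * (k - a') := by
  intro a' ha'
  obtain ⟨a₁, rfl⟩ : ∃ a₁, a = a₁ + 1 := ⟨a - 1, by omega⟩
  obtain ⟨b, rfl⟩ : ∃ b, k = a₁ + 1 + (a₁ + 5 + b) := ⟨k - (2 * a₁ + 6), by omega⟩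
  have hprod : (a₁ + 1) * (a₁ + 1 + (a₁ + 5 + b) - (a₁ + 1)) = (a₁ + 1) * (a₁ + 5 + b) := by
    congr 1; omega
  rw [hprod]
  by_cases hsmall : a' ≤ a₁ ∨ a₁ + 1 + (a₁ + 5 + b) ≤ a' + a₁
  · -- below the previous product `a₁ (k − a₁)`
    have h := prod_le_of_small a' (a₁ + 1 + (a₁ + 5 + b)) a₁ ha' (by omega) hsmall
    have e : a₁ + 1 + (a₁ + 5 + b) - a₁ = a₁ + 6 + b := by omega
    rw [e] at h
    have : a₁ * (a₁ + 6 + b) + 5 ≤ (a₁ + 1) * (a₁ + 5 + b) := by ring_nf; omega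
    omega
  · push Not at hsmall
    by_cases hmid : a₁ + 2 ≤ a' ∧ a' + (a₁ + 2) ≤ a₁ + 1 + (a₁ + 5 + b)
    · -- above the next product `(a₁ + 2)(k − a₁ − 2)`
      have h := prod_ge_of_between a' (a₁ + 1 + (a₁ + 5 + b)) (a₁ + 2) hmid.1 hmid.2
      have e : a₁ + 1 + (a₁ + 5 + b) - (a₁ + 2) = a₁ + 4 + b := by omega
      rw [e] at h
      have : (a₁ + 1) * (a₁ + 5 + b) + 1 ≤ (a₁ + 2) * (a₁ + 4 + b) := by ring_nf; omega
      omega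
    · -- `a′ = a` or `a′ = k − a`: the product itself
      push Not at hmid
      have hcases : a' = a₁ + 1 ∨ a' = a₁ + 5 + b := by omega
      have hX : 5 ≤ (a₁ + 1) * (a₁ + 5 + b) := by nlinarith
      rcases hcases with rfl | rfl
      · rw [hprod]; omega
      · have e : a₁ + 1 + (a₁ + 5 + b) - (a₁ + 5 + b) = a₁ + 1 := by omega
        have hprod2 : (a₁ + 5 + b) * (a₁ + 1 + (a₁ + 5 + b) - (a₁ + 5 + b)) = (a₁ + 1) * (a₁ + 5 + b) := by
          rw [e, mul_comm]
        rw [hprod2]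
        omega

/-- **FOUR BELOW THE DIAGONAL IS EXACT ON THE `K₄⁻`-FREE CLASS FOR THE CELLS `m = 3 (k − 3) − 4`, EVERY `k ≥ 13`.** -/
theorem four_below_diagonal_exact_k4m_three_all (k : ℕ) (hk : 13 ≤ k) :
    (∀ (D : SimpleGraph (Fin k)) [DecidableRel D.Adj], K4mFree D →
        D.edgeFinset.card = 3 * (k - 3) - 4 →
        2 * cherries D + 4 * (k - 5) ≤ (3 * (k - 3) - 4) * (k - 2)) ∧
      ∃ (D : SimpleGraph (Fin k)) (_ : DecidableRel D.Adj), K4mFree D ∧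
        D.edgeFinset.card = 3 * (k - 3) - 4 ∧ 2 * cherries D + 4 * (k - 5) = (3 * (k - 3) - 4) * (k - 2) :=
  four_below_diagonal_exact_k4m_three k hk (products_avoid k 3 (by norm_num) (by omega))

/-- **FOUR BELOW THE DIAGONAL IS EXACT ON THE `K₄⁻`-FREE CLASS FOR THE CELLS `m = 4 (k − 4) − 4`, EVERY `k ≥ 13`.** -/
theorem four_below_diagonal_exact_k4m_four_all (k : ℕ) (hk : 13 ≤ k) :
    (∀ (D : SimpleGraph (Fin k)) [DecidableRel D.Adj], K4mFree D →
        D.edgeFinset.card = 4 * (k - 4) - 4 →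
        2 * cherries D + 4 * (k - 5) ≤ (4 * (k - 4) - 4) * (k - 2)) ∧
      ∃ (D : SimpleGraph (Fin k)) (_ : DecidableRel D.Adj), K4mFree D ∧
        D.edgeFinset.card = 4 * (k - 4) - 4 ∧ 2 * cherries D + 4 * (k - 5) = (4 * (k - 4) - 4) * (k - 2) :=
  four_below_diagonal_exact_k4m_four k hk (products_avoid k 4 (by norm_num) (by omega))

/-- **THE DENSE CELLS NEED NO RESIDUE:** when `4k ≤ a (k − a) + 10` the one-triangle hypothesis of the assembly
is vacuous (`10 q + 2m + 28 ≥ 8k`), and four below the diagonal is exact modulo the products alone. -/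
theorem four_below_diagonal_exact_k4m_of_dense (k a : ℕ) (hk : 13 ≤ k) (ha : 1 ≤ a) (hak : a + 4 ≤ k)
    (hd : 4 * k ≤ a * (k - a) + 10)
    (hm : ∀ a', a' ≤ k → a * (k - a) - 4 ≠ a' * (k - a') ∧ a * (k - a) - 3 ≠ a' * (k - a') ∧
      a * (k - a) - 2 ≠ a' * (k - a') ∧ a * (k - a) - 1 ≠ a' * (k - a')) :
    (∀ (D : SimpleGraph (Fin k)) [DecidableRel D.Adj], K4mFree D →
        D.edgeFinset.card = a * (k - a) - 4 →
        2 * cherries D + 4 * (k - 5) ≤ (a * (k - a) - 4) * (k - 2)) ∧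
      ∃ (D : SimpleGraph (Fin k)) (_ : DecidableRel D.Adj), K4mFree D ∧
        D.edgeFinset.card = a * (k - a) - 4 ∧ 2 * cherries D + 4 * (k - 5) = (a * (k - a) - 4) * (k - 2) := by
  apply four_below_diagonal_exact_k4m_of_thirteen_modulo k a hk ha hak (by omega) hm
  intro D _ _ hD u v w _ _ _ _ _ hpay _
  exfalso
  rw [hD] at hpay
  omega

/-- **EVERY CELL `a ≥ 6` OF THE SUB-DIAGONAL `r = 4` WITH `2a + 4 ≤ k` IS EXACT ON THE `K₄⁻`-FREE CLASS** (`k ≥ 13`). -/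
theorem four_below_diagonal_exact_k4m_of_six (k a : ℕ) (hk : 13 ≤ k) (ha : 6 ≤ a) (hak : 2 * a + 4 ≤ k) :
    (∀ (D : SimpleGraph (Fin k)) [DecidableRel D.Adj], K4mFree D →
        D.edgeFinset.card = a * (k - a) - 4 →
        2 * cherries D + 4 * (k - 5) ≤ (a * (k - a) - 4) * (k - 2)) ∧
      ∃ (D : SimpleGraph (Fin k)) (_ : DecidableRel D.Adj), K4mFree D ∧
        D.edgeFinset.card = a * (k - a) - 4 ∧ 2 * cherries D + 4 * (k - 5) = (a * (k - a) - 4) * (k - 2) := by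
  apply four_below_diagonal_exact_k4m_of_dense k a hk (by omega) (by omega) ?_
    (products_avoid k a (by omega) hak)
  have h := prod_ge_of_between a k 6 ha (by omega)
  have e : 6 * (k - 6) + 26 = 6 * k - 10 := by omega
  omega

/-- **THE CELLS `a = 5` OF THE SUB-DIAGONAL `r = 4` ARE EXACT ON THE `K₄⁻`-FREE CLASS FOR EVERY `k ≥ 15`.** -/
theorem four_below_diagonal_exact_k4m_of_five (k : ℕ) (hk : 15 ≤ k) :
    (∀ (D : SimpleGraph (Fin k)) [DecidableRel D.Adj], K4mFree D →
        D.edgeFinset.card = 5 * (k - 5) - 4 →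
        2 * cherries D + 4 * (k - 5) ≤ (5 * (k - 5) - 4) * (k - 2)) ∧
      ∃ (D : SimpleGraph (Fin k)) (_ : DecidableRel D.Adj), K4mFree D ∧
        D.edgeFinset.card = 5 * (k - 5) - 4 ∧ 2 * cherries D + 4 * (k - 5) = (5 * (k - 5) - 4) * (k - 2) := by
  apply four_below_diagonal_exact_k4m_of_dense k 5 (by omega) (by norm_num) (by omega) (by omega)
    (products_avoid k 5 (by norm_num) (by omega))

end C047

end TriangleCap

end PercRepro
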